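import Summits.PneNP.PneNP.Theses.SymmetryBudget
import Literature.Computability.Complexity.SymmetricCircuit
import Literature.ModelTheory.FiniteModelTheory.CkEquiv

/-!
# Crux-ideate sketch — WindowBarrier (stmt-PneNP-2145), ideator 2, round 1

First lemmas of the idea card `colouring-graph-duality` (statements only, sorry-free
`def … : Prop`; nothing here is an item, nothing is proposed).

Core form (free part only, full symmetry, size `2^{c n}`; the route's window `g = ⌊log₂ m⌋`
makes `poly(m) = 2^{O(g)}`; the restriction "core ⇒ window" is the published plumbing
`IdeaSketch.FreeCoreToWindow` of ideator 1 and is not repeated).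

* `homCount` — the partition function of the input graph into a constant-size weighted target;
* `RightProfileCheap` — partition functions into constant-size targets are window-cheap
  (provable now: colouring-indexed gates, orbit `q^n`, symmetric iterated addition);
* `CoreFooling` — core form of the picked line's transfer target S4 (fooling pairs);
* `ProfileFilter` — hence every fooling pair is Potts/Ising-indistinguishable (provable now);
* `CompleteFamilyKillsFooling` — the kill-switch: a window-cheap family of invariants that is
  jointly complete for isomorphism leaves no fooling pairs (provable now, pure logic);
* `JointProfileComplete` — the finite-target Lovász question whose answer decides which way
  the kill-switch / the witness supply goes (open; the card's `Transfer`).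
-/

noncomputable section

open Classical Filter
open scoped BigOperators
open Literature.Computability.Complexity Literature.ModelTheory.FiniteModelTheory

namespace Summit.PneNP.PneNP.Cruxes.WindowBarrier.IdeaSketchK2

/-- The route's reading of a Boolean matrix as a simple graph. -/
def Gr (n : ℕ) (x : Fin n × Fin n → Bool) : SimpleGraph (Fin n) :=
  SimpleGraph.fromRel fun u v => x (u, v) = true

/-- The **partition function** of the `n`-vertex input graph into the weighted target on `Fin q`
with vertex weights `α` and edge weights `H` (right homomorphism count when `α = 1` and `H` is
`0/1`): `Z(x) = ∑_{χ : V → Fin q} ∏_v α(χ v) · ∏_{u<v, uv ∈ E} H(χ u, χ v)`. -/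
def homCount (q : ℕ) (α : Fin q → ℕ) (H : Fin q → Fin q → ℕ) (n : ℕ)
    (x : Fin n × Fin n → Bool) : ℕ :=
  ∑ χ : Fin n → Fin q,
    (∏ v : Fin n, α (χ v)) *
      ∏ u : Fin n, ∏ v : Fin n, (if u < v ∧ (Gr n x).Adj u v then H (χ u) (χ v) else 1)

/-- **RightProfileCheap** (first lemma, provable now). For every constant-size weighted target,
every bit of the partition function of the input graph has FULLY symmetric threshold circuits of
size `2^{O(n)}`: one sub-circuit per colouring `χ` (orbit `q^n = 2^{n log₂ q}`), the product is an
iterated multiplication of `≤ n²+n` constant-size numbers (poly-size threshold circuits), and the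
sum over all `χ` is computed SYMMETRICALLY from the counts `c_i = #{χ : bit i of term_χ = 1}`
(threshold gates over the `χ`-orbit) followed by an ordinary circuit on the `O(n² log q)` bits of
the `c_i`. Hence right homomorphism profiles over targets of size `≤ 2^D` lie inside the window. -/
def RightProfileCheap : Prop :=
  ∀ (q : ℕ) (α : Fin q → ℕ) (H : Fin q → Fin q → ℕ), ∃ c : ℕ, ∀ n i : ℕ,
    HasSymCircuit tcBasis (Set.univ : Set (Equiv.Perm (Fin n))) (2 ^ (c * (n + 1)))
      (fun x : Fin n × Fin n → Bool => (homCount q α H n x).testBit i)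

/-- Two inputs are **indistinguishable by fully symmetric threshold circuits of size `≤ s`**. -/
def SymIndist (n s : ℕ) (x y : Fin n × Fin n → Bool) : Prop :=
  ∀ C : Circuit (Fin n × Fin n), C.IsOver tcBasis → C.size ≤ s →
    C.IsSymmetricUnder (Set.univ : Set (Equiv.Perm (Fin n))) → C.eval x = C.eval y

/-- **CoreFooling c** — core form of the picked line's transfer target
`stub_symmetricIndistinguishability` (S4) at exponent `c`: infinitely often there are two
NON-isomorphic `n`-vertex graphs indistinguishable by every fully symmetric threshold circuit of
size `≤ 2^{c n}`. (`∀ c, CoreFooling c` ⇒ S4 by planting on the free part; S4 ⇒ WindowBarrier is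
the lead's kernel-checked composition.) -/
def CoreFooling (c : ℕ) : Prop :=
  ∃ᶠ n in atTop, ∃ x y : Fin n × Fin n → Bool,
    IsEmpty (Gr n x ≃g Gr n y) ∧ SymIndist n (2 ^ (c * n)) x y

/-- **ProfileFilter** (provable now from `RightProfileCheap`): a fooling pair at exponent `c(q,α,H)`
has equal partition functions into the target `(q, α, H)`. With `RightProfileCheap` uniform in
the target size this says: S4-witnesses are Potts/Ising-indistinguishable for every number of
states `≤ 2^D` and all couplings/fields — a necessary condition ORTHOGONAL to `C^k`-equivalence,
multiplicative under disjoint union (`Z(F ⊔ F') = Z(F) Z(F')`), hence lethal for twin-pair /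
disjoint-union ansätze unless the halves are themselves profile-equal. -/
def ProfileFilter : Prop :=
  ∀ (q : ℕ) (α : Fin q → ℕ) (H : Fin q → Fin q → ℕ), ∃ c : ℕ, ∀ n : ℕ,
    ∀ x y : Fin n × Fin n → Bool, SymIndist n (2 ^ (c * (n + 1))) x y →
      homCount q α H n x = homCount q α H n y

/-- A family `I k` (`k : ℕ`) of Boolean graph invariants is **jointly complete from `n₀` on** if
`n`-vertex graphs (`n ≥ n₀`) agreeing on every `I k n` with `k ≤ K n` are isomorphic. -/
def JointlyComplete (I : ℕ → (n : ℕ) → (Fin n × Fin n → Bool) → Bool) (K : ℕ → ℕ) (n₀ : ℕ) :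
    Prop :=
  ∀ n, n₀ ≤ n → ∀ x y : Fin n × Fin n → Bool,
    (∀ k, k ≤ K n → I k n x = I k n y) → Nonempty (Gr n x ≃g Gr n y)

/-- **CompleteFamilyKillsFooling** (the kill-switch; provable now, pure logic): if some family of
invariants is computable by fully symmetric threshold circuits of size `≤ 2^{c₀ n}` EACH and is
jointly complete from some `n₀` on, then there are no fooling pairs at exponent `c₀`
(each `I k n`, `k ≤ K n`, is one symmetric circuit the pair would have to fool). So a finite-target
Lovász theorem for window-cheap profiles refutes S4 / `stub_witness` of BOTH surviving lines. -/
def CompleteFamilyKillsFooling : Prop :=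
  ∀ (I : ℕ → (n : ℕ) → (Fin n × Fin n → Bool) → Bool) (K : ℕ → ℕ) (n₀ c₀ : ℕ),
    (∀ k n, k ≤ K n →
      HasSymCircuit tcBasis (Set.univ : Set (Equiv.Perm (Fin n))) (2 ^ (c₀ * n)) (I k n)) →
    JointlyComplete I K n₀ → ¬ CoreFooling c₀

/-- **JointProfileComplete q k** (the card's finite-target Lovász question, OPEN): for all large
`n`, two `n`-vertex graphs that are `C^{k n}`-equivalent (`k n = n / log₂ n` is affordable in the
window) AND have equal partition functions into every weighted target on `≤ q` nodes with weights
`< n` are isomorphic. TRUE for some constant `q` ⇒ (with `RightProfileCheap` and the window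
`C^{n/log n}` compilation) the kill-switch fires: ¬S4, ¬stub_witness. FALSE for every `q` ⇒ the
colliding pairs are exactly the depth-one candidates for `CoreFooling`, supplied by algebra
(interpolation / connection matrices), not by gauge twists. -/
def JointProfileComplete (q : ℕ) (k : ℕ → ℕ) : Prop :=
  ∃ n₀ : ℕ, ∀ n, n₀ ≤ n → ∀ x y : Fin n × Fin n → Bool,
    CkEquiv (k n) (Gr n x) (Gr n y) →
    (∀ (q' : ℕ) (α : Fin q' → ℕ) (H : Fin q' → Fin q' → ℕ), q' ≤ q →
        (∀ i, α i < n) → (∀ i j, H i j < n) → homCount q' α H n x = homCount q' α H n y) →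
    Nonempty (Gr n x ≃g Gr n y)

end Summit.PneNP.PneNP.Cruxes.WindowBarrier.IdeaSketchK2
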